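import Summits.CriticalPhenomena.PercolationContinuityZ3.Theorems.PercNearOneGluingNoHeavyLowerTailSahiOneStepLayerMonotone
import Mathlib.Combinatorics.SetFamily.FourFunctions
import Mathlib.Data.Finset.Sort
import HarnessLib

/-!
# One-step scheme: FKG ON THE GALE LATTICE OF A LAYER — same-direction shifted events are nonnegatively correlated on every layer,
# for EVERY product measure

Support file (prover prim-ineq-prove-3 gen 30; `--supports stmt-CriticalPhenomena-4575`; memo
`run/shared/lean/prim/prim-ineq-prove-3/FINDING-G30-SHIFTED-PAIRS.md` §2).  No definitions, no named facts, no sorries, no `native_decide`.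

Fix a linear order on `ι` and a block `F`.  The `k`-subsets of `F` are the images of the strictly increasing maps `a : Fin k → ι` with values in
`F`; ordered coordinatewise (`a ≤ b` iff `a s ≤ b s` for all `s` — the Gale / dominance order) these maps form a sublattice of the distributive
lattice `Fin k → ι` (`⊓`, `⊔` = pointwise `min`, `max`).  KEY FACT (`wtW_image_inf_mul_sup`): the Bernoulli weight `T ↦ ∏_{i∈T} pᵢ ∏_{i∈F∖T}(1−pᵢ)`
is LOG-MODULAR on this lattice for EVERY density vector `p` (the multiset `{a s, b s}_s` is preserved by `(min,max)`), so the Ahlswede–Daykin /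
FKG inequality (Mathlib `four_functions_theorem_univ`) applies on each layer with no assumption relating `p` to the order:
* `sum_layer_fkg_of_galeMonotone` — for pattern functions `φ, ψ ≥ 0` that are nondecreasing in the Gale order on the `k`-subsets of `F`,
  `(Σ_k w φ)(Σ_k w ψ) ≤ (Σ_k w)(Σ_k w φ ψ)` (sums over the `k`-subsets of `F`, `w` the Bernoulli weight);
* `galeMonotone_of_rightShifted` — an event that is RIGHT-SHIFTED on `F` (`T ∈ A`, `i ∈ T`, `j ∈ F ∖ T`, `i < j` ⟹ `T − i + j ∈ A`) is
  nondecreasing in the Gale order on every layer;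
* **`real_layer_mul_le_of_rightShifted`**: for increasing... (any) events `A, B` determined by `F` and right-shifted on `F`, and every `k`,
  `μ(A ∩ {N_F=k})·μ(B ∩ {N_F=k}) ≤ μ(A ∩ B ∩ {N_F=k})·μ{N_F=k}` — the hypothesis of the layer criterion `osN_threshold_nonneg_of_layerPos`
  (`…SahiOneStepLayerPositive`), whence `(2′)` and Kahn C5 / Sahi C₃ for two events shifted in the same direction (`…SahiOneStepShiftedPairs`).
-/

noncomputable section

namespace Summit.CriticalPhenomena.PercolationContinuityZ3.Theorems

namespace SahiOneStep

open MeasureTheory Finset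
open Literature.Probability.Percolation (DeterminedBy determinedBy_iff)
open Literature.Probability.LatticeModels (prodBernoulli)
open Literature.Probability.Percolation.DecisionTree (ind wtW ind_of_mem ind_of_not_mem ind_nonneg)
open Literature.Probability.Percolation.BHK2006 (ind_inter)
open scoped Classical

variable {ι : Type*} [Fintype ι] [LinearOrder ι]

/-! ## §1 The Gale lattice: pointwise `min` / `max` of strictly increasing sequences -/

omit [Fintype ι] in
/-- Pointwise `min` of strictly increasing maps is strictly increasing. [folklore] -/
theorem strictMono_inf {k : ℕ} {a b : Fin k → ι} (ha : StrictMono a) (hb : StrictMono b) : StrictMono (a ⊓ b) :=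
  fun s s' h => by simp only [Pi.inf_apply]; exact min_lt_min (ha h) (hb h)

omit [Fintype ι] in
/-- Pointwise `max` of strictly increasing maps is strictly increasing. [folklore] -/
theorem strictMono_sup {k : ℕ} {a b : Fin k → ι} (ha : StrictMono a) (hb : StrictMono b) : StrictMono (a ⊔ b) :=
  fun s s' h => by simp only [Pi.sup_apply]; exact max_lt_max (ha h) (hb h)

omit [Fintype ι] in
/-- The images of `a ⊓ b` and `a ⊔ b` cover the same points as those of `a` and `b`. [folklore] -/
theorem image_inf_union_image_sup {k : ℕ} (a b : Fin k → ι) :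
    univ.image (a ⊓ b) ∪ univ.image (a ⊔ b) = univ.image a ∪ univ.image b := by
  ext i
  simp only [mem_union, mem_image, mem_univ, true_and, Pi.inf_apply, Pi.sup_apply]
  constructor
  · rintro (⟨s, hs⟩ | ⟨s, hs⟩)
    · rcases min_choice (a s) (b s) with h | h
      · exact Or.inl ⟨s, by rw [← hs, h]⟩
      · exact Or.inr ⟨s, by rw [← hs, h]⟩
    · rcases max_choice (a s) (b s) with h | h
      · exact Or.inl ⟨s, by rw [← hs, h]⟩
      · exact Or.inr ⟨s, by rw [← hs, h]⟩
  · rintro (⟨s, hs⟩ | ⟨s, hs⟩)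
    · by_cases h : a s ≤ b s
      · exact Or.inl ⟨s, by rw [min_eq_left h, hs]⟩
      · exact Or.inr ⟨s, by rw [max_eq_left (le_of_not_ge h), hs]⟩
    · by_cases h : b s ≤ a s
      · exact Or.inl ⟨s, by rw [min_eq_right h, hs]⟩
      · exact Or.inr ⟨s, by rw [max_eq_right (le_of_not_ge h), hs]⟩

omit [Fintype ι] in
/-- A common point of the images of two strictly increasing maps lies in the images of both `a ⊓ b` and `a ⊔ b`. [folklore] -/
theorem image_inter_subset_image_inf_inter {k : ℕ} {a b : Fin k → ι} (ha : StrictMono a) (hb : StrictMono b) :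
    univ.image a ∩ univ.image b ⊆ univ.image (a ⊓ b) ∩ univ.image (a ⊔ b) := by
  intro i hi
  simp only [mem_inter, mem_image, mem_univ, true_and, Pi.inf_apply, Pi.sup_apply] at hi ⊢
  obtain ⟨⟨s, hs⟩, ⟨s', hs'⟩⟩ := hi
  by_cases h1 : a s ≤ b s
  · -- `i ∈ img (a ⊓ b)` via `s`
    refine ⟨⟨s, by rw [min_eq_left h1, hs]⟩, ?_⟩
    by_cases h2 : a s' ≤ b s'
    · exact ⟨s', by rw [max_eq_right h2, hs']⟩
    · exfalso
      have hlt : b s' < a s' := lt_of_not_ge h2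
      rw [hs'] at hlt; rw [← hs] at hlt
      have hss' : s < s' := ha.lt_iff_lt.1 hlt
      have := hb hss'
      rw [hs'] at this
      exact absurd (h1.trans_lt (hs ▸ this)) (lt_irrefl _)
  · have h1' : b s < a s := lt_of_not_ge h1
    refine ⟨?_, ⟨s, by rw [max_eq_left h1'.le, hs]⟩⟩
    by_cases h2 : b s' ≤ a s'
    · exact ⟨s', by rw [min_eq_right h2, hs']⟩
    · exfalso
      have hlt : a s' < b s' := lt_of_not_ge h2
      rw [hs'] at hlt; rw [← hs] at hlt
      have hss' : s' < s := ha.lt_iff_lt.1 hlt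
      have := hb hss'
      rw [hs'] at this
      exact absurd (this.trans h1') (by rw [hs]; exact lt_irrefl _)

omit [Fintype ι] in
/-- The images of `a ⊓ b`, `a ⊔ b` meet exactly where those of `a`, `b` meet. [folklore] -/
theorem image_inf_inter_image_sup {k : ℕ} {a b : Fin k → ι} (ha : StrictMono a) (hb : StrictMono b) :
    univ.image (a ⊓ b) ∩ univ.image (a ⊔ b) = univ.image a ∩ univ.image b := by
  symm
  apply Finset.eq_of_subset_of_card_le (image_inter_subset_image_inf_inter ha hb)
  have hca : (univ.image a).card = k := by rw [card_image_of_injective _ ha.injective, card_univ, Fintype.card_fin]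
  have hcb : (univ.image b).card = k := by rw [card_image_of_injective _ hb.injective, card_univ, Fintype.card_fin]
  have hci : (univ.image (a ⊓ b)).card = k := by
    rw [card_image_of_injective _ (strictMono_inf ha hb).injective, card_univ, Fintype.card_fin]
  have hcs : (univ.image (a ⊔ b)).card = k := by
    rw [card_image_of_injective _ (strictMono_sup ha hb).injective, card_univ, Fintype.card_fin]
  have h1 := Finset.card_union_add_card_inter (univ.image a) (univ.image b)
  have h2 := Finset.card_union_add_card_inter (univ.image (a ⊓ b)) (univ.image (a ⊔ b))
  rw [image_inf_union_image_sup a b] at h2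
  omega

omit [Fintype ι] in
/-- **LOG-MODULARITY of the Bernoulli weight on the Gale lattice** (every density vector): `w(img(a⊓b))·w(img(a⊔b)) = w(img a)·w(img b)`.
[this work] -/
theorem wtW_image_inf_mul_sup (F : Finset ι) (pr : ι → ℝ) {k : ℕ} {a b : Fin k → ι} (ha : StrictMono a) (hb : StrictMono b) :
    wtW F pr (univ.image (a ⊓ b)) * wtW F pr (univ.image (a ⊔ b)) = wtW F pr (univ.image a) * wtW F pr (univ.image b) := by
  rw [wtW_mul_wtW_eq, wtW_mul_wtW_eq, image_inf_inter_image_sup ha hb, image_inf_union_image_sup a b]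

/-! ## §2 From `k`-subsets of `F` to strictly increasing sequences -/

/-- **Reindexing a layer sum by strictly increasing sequences.** [folklore] -/
theorem sum_layer_eq_sum_strictMono (F : Finset ι) (k : ℕ) (G : Finset ι → ℝ) :
    ∑ T ∈ F.powerset.filter (fun T => T.card = k), G T =
      ∑ a ∈ (univ : Finset (Fin k → ι)).filter (fun a => StrictMono a ∧ ∀ s, a s ∈ F), G (univ.image a) := by
  symm
  refine Finset.sum_bij' (fun a _ => univ.image a) (fun T hT => (T.orderEmbOfFin (Finset.mem_filter.1 hT).2 : Fin k → ι))
    ?_ ?_ ?_ ?_ ?_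
  · intro a ha
    rw [Finset.mem_filter] at ha ⊢
    refine ⟨Finset.mem_powerset.2 fun i hi => ?_, ?_⟩
    · obtain ⟨s, _, rfl⟩ := Finset.mem_image.1 hi
      exact ha.2.2 s
    · rw [card_image_of_injective _ ha.2.1.injective, card_univ, Fintype.card_fin]
  · intro T hT
    rw [Finset.mem_filter] at hT ⊢
    refine ⟨Finset.mem_univ _, (T.orderEmbOfFin hT.2).strictMono, fun s => ?_⟩
    exact Finset.mem_powerset.1 hT.1 (T.orderEmbOfFin_mem hT.2 s)
  · intro a ha
    rw [Finset.mem_filter] at ha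
    exact (Finset.orderEmbOfFin_unique _ (fun s => Finset.mem_image_of_mem a (Finset.mem_univ s)) ha.2.1).symm
  · intro T hT
    exact Finset.image_orderEmbOfFin_univ T (Finset.mem_filter.1 hT).2
  · intro a _; rfl

/-! ## §3 FKG on a layer for Gale-monotone pattern functions -/

/-- **FKG on the Gale lattice of the `k`-subsets of `F`** (Ahlswede–Daykin with the log-modular Bernoulli weight).  If `φ, ψ ≥ 0` are
nondecreasing in the Gale order (`a ≤ b` pointwise for the increasing enumerations ⟹ `φ(img a) ≤ φ(img b)`), then
`(Σ w φ)(Σ w ψ) ≤ (Σ w)(Σ w φ ψ)` over the `k`-subsets of `F`, for EVERY `p : ι → [0,1]`. [this work] -/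
theorem sum_layer_fkg_of_galeMonotone (F : Finset ι) (pr : ι → ℝ) (hp0 : ∀ i, 0 ≤ pr i) (hp1 : ∀ i, pr i ≤ 1) (k : ℕ)
    (φ ψ : Finset ι → ℝ) (hφ : ∀ T, 0 ≤ φ T) (hψ : ∀ T, 0 ≤ ψ T)
    (monoφ : ∀ a b : Fin k → ι, StrictMono a → StrictMono b → (∀ s, a s ∈ F) → (∀ s, b s ∈ F) → a ≤ b →
      φ (univ.image a) ≤ φ (univ.image b))
    (monoψ : ∀ a b : Fin k → ι, StrictMono a → StrictMono b → (∀ s, a s ∈ F) → (∀ s, b s ∈ F) → a ≤ b →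
      ψ (univ.image a) ≤ ψ (univ.image b)) :
    (∑ T ∈ F.powerset.filter (fun T => T.card = k), wtW F pr T * φ T) *
        (∑ T ∈ F.powerset.filter (fun T => T.card = k), wtW F pr T * ψ T) ≤
      (∑ T ∈ F.powerset.filter (fun T => T.card = k), wtW F pr T) *
        (∑ T ∈ F.powerset.filter (fun T => T.card = k), wtW F pr T * (φ T * ψ T)) := by
  -- the weight on all maps `Fin k → ι`, vanishing off the strictly increasing `F`-valued ones
  set μ : (Fin k → ι) → ℝ := fun a => if StrictMono a ∧ ∀ s, a s ∈ F then wtW F pr (univ.image a) else 0 with hμ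
  have hw0 : ∀ T, 0 ≤ wtW F pr T := fun T =>
    Literature.Probability.Percolation.DecisionTree.wtW_nonneg F hp0 hp1 T
  have hμ0 : ∀ a, 0 ≤ μ a := fun a => by rw [hμ]; dsimp only; split_ifs; exacts [hw0 _, le_rfl]
  -- every filtered layer sum is a sum over all maps against `μ`
  have conv : ∀ G : Finset ι → ℝ, ∑ T ∈ F.powerset.filter (fun T => T.card = k), wtW F pr T * G T =
      ∑ a : Fin k → ι, μ a * G (univ.image a) := by
    intro G
    rw [sum_layer_eq_sum_strictMono F k (fun T => wtW F pr T * G T), Finset.sum_filter]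
    refine Finset.sum_congr rfl fun a _ => ?_
    rw [hμ]; dsimp only
    split_ifs <;> simp
  have conv1 : ∑ T ∈ F.powerset.filter (fun T => T.card = k), wtW F pr T = ∑ a : Fin k → ι, μ a := by
    have h := conv (fun _ => 1)
    simp only [mul_one] at h
    exact h
  rw [conv φ, conv ψ, conv1, conv (fun T => φ T * ψ T)]
  -- Ahlswede–Daykin on the distributive lattice `Fin k → ι`
  have h4 := four_functions_theorem_univ (fun a => μ a * φ (univ.image a)) (fun a => μ a * ψ (univ.image a)) μ
    (fun a => μ a * (φ (univ.image a) * ψ (univ.image a)))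
    (fun a => mul_nonneg (hμ0 a) (hφ _)) (fun a => mul_nonneg (hμ0 a) (hψ _)) hμ0
    (fun a => mul_nonneg (hμ0 a) (mul_nonneg (hφ _) (hψ _))) ?_
  · simpa using h4
  intro a b
  by_cases ha : StrictMono a ∧ ∀ s, a s ∈ F
  · by_cases hb : StrictMono b ∧ ∀ s, b s ∈ F
    · have hi : StrictMono (a ⊓ b) ∧ ∀ s, (a ⊓ b) s ∈ F :=
        ⟨strictMono_inf ha.1 hb.1, fun s => by
          simp only [Pi.inf_apply]; rcases min_choice (a s) (b s) with h | h <;> rw [h]; exacts [ha.2 s, hb.2 s]⟩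
      have hs : StrictMono (a ⊔ b) ∧ ∀ s, (a ⊔ b) s ∈ F :=
        ⟨strictMono_sup ha.1 hb.1, fun s => by
          simp only [Pi.sup_apply]; rcases max_choice (a s) (b s) with h | h <;> rw [h]; exacts [ha.2 s, hb.2 s]⟩
      have eμ : μ (a ⊓ b) * μ (a ⊔ b) = μ a * μ b := by
        rw [hμ]; dsimp only
        rw [if_pos ha, if_pos hb, if_pos hi, if_pos hs]
        exact wtW_image_inf_mul_sup F pr ha.1 hb.1
      have hφle : φ (univ.image a) ≤ φ (univ.image (a ⊔ b)) := monoφ a (a ⊔ b) ha.1 hs.1 ha.2 hs.2 le_sup_left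
      have hψle : ψ (univ.image b) ≤ ψ (univ.image (a ⊔ b)) := monoψ b (a ⊔ b) hb.1 hs.1 hb.2 hs.2 le_sup_right
      calc μ a * φ (univ.image a) * (μ b * ψ (univ.image b))
          = (μ a * μ b) * (φ (univ.image a) * ψ (univ.image b)) := by ring
        _ ≤ (μ (a ⊓ b) * μ (a ⊔ b)) * (φ (univ.image (a ⊔ b)) * ψ (univ.image (a ⊔ b))) := by
          rw [eμ]
          exact mul_le_mul_of_nonneg_left (mul_le_mul hφle hψle (hψ _) (hφ _)) (mul_nonneg (hμ0 a) (hμ0 b))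
        _ = μ (a ⊓ b) * (μ (a ⊔ b) * (φ (univ.image (a ⊔ b)) * ψ (univ.image (a ⊔ b)))) := by ring
    · have : μ b = 0 := by rw [hμ]; dsimp only; rw [if_neg hb]
      rw [this, zero_mul, mul_zero]
      exact mul_nonneg (hμ0 _) (mul_nonneg (hμ0 _) (mul_nonneg (hφ _) (hψ _)))
  · have : μ a = 0 := by rw [hμ]; dsimp only; rw [if_neg ha]
    rw [this, zero_mul, zero_mul]
    exact mul_nonneg (hμ0 _) (mul_nonneg (hμ0 _) (mul_nonneg (hφ _) (hψ _)))

/-! ## §4 Right-shifted events are Gale-monotone on every layer -/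

omit [Fintype ι] in
/-- **Right-shifted ⟹ nondecreasing in the Gale order.**  If the pattern family of `A` inside `F` is right-shifted
(`T ∈ A`, `i ∈ T`, `j ∈ F ∖ T`, `i < j` ⟹ `insert j (T.erase i) ∈ A`), then for strictly increasing `F`-valued `a ≤ b` (pointwise),
`img a ∈ A ⟹ img b ∈ A`. [this work] -/
theorem galeMonotone_of_rightShifted (F : Finset ι) {A : Set (Set ι)}
    (hAs : ∀ T : Finset ι, T ⊆ F → (↑T : Set ι) ∈ A → ∀ i ∈ T, ∀ j ∈ F, j ∉ T → i < j → (↑(insert j (T.erase i)) : Set ι) ∈ A)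
    {k : ℕ} {a b : Fin k → ι} (ha : StrictMono a) (hb : StrictMono b) (haF : ∀ s, a s ∈ F) (hbF : ∀ s, b s ∈ F) (hab : a ≤ b)
    (hA : (↑(univ.image a) : Set ι) ∈ A) : (↑(univ.image b) : Set ι) ∈ A := by
  -- induction on the number of positions where `a < b`
  suffices main : ∀ n : ℕ, ∀ a : Fin k → ι, StrictMono a → (∀ s, a s ∈ F) → a ≤ b →
      (univ.filter fun s => a s < b s).card = n → (↑(univ.image a) : Set ι) ∈ A → (↑(univ.image b) : Set ι) ∈ A from
    main _ a ha haF hab rfl hA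
  intro n
  induction n using Nat.strong_induction_on with
  | _ n ih =>
    intro a ha haF hab hn hA
    set D := univ.filter fun s => a s < b s with hD
    by_cases hDe : D = ∅
    · -- no position differs: `a = b`
      have hEq : a = b := by
        funext s
        have hs : ¬ a s < b s := by
          intro hlt
          have : s ∈ D := Finset.mem_filter.2 ⟨Finset.mem_univ s, hlt⟩
          rw [hDe] at this; exact Finset.notMem_empty s this
        exact le_antisymm (hab s) (not_lt.1 hs)
      rw [← hEq]; exact hA
    · have hDne : D.Nonempty := Finset.nonempty_iff_ne_empty.2 hDe
      set s₀ := D.max' hDne with hs₀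
      have hs₀D : s₀ ∈ D := Finset.max'_mem D hDne
      have hs₀lt : a s₀ < b s₀ := (Finset.mem_filter.1 hs₀D).2
      -- above `s₀` the two sequences agree
      have hagree : ∀ s, s₀ < s → a s = b s := by
        intro s hs
        by_contra hne
        have hlt : a s < b s := lt_of_le_of_ne (hab s) hne
        have hsD : s ∈ D := Finset.mem_filter.2 ⟨Finset.mem_univ s, hlt⟩
        exact absurd (Finset.le_max' D s hsD) (by rw [← hs₀]; exact not_le.2 hs)
      -- the one-step move
      set a₁ : Fin k → ι := Function.update a s₀ (b s₀) with ha₁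
      have a₁_s₀ : a₁ s₀ = b s₀ := by rw [ha₁]; exact Function.update_self _ _ _
      have a₁_ne : ∀ s, s ≠ s₀ → a₁ s = a s := fun s hs => by rw [ha₁]; exact Function.update_of_ne hs _ _
      have ha₁mono : StrictMono a₁ := by
        intro s s' hss'
        by_cases h1 : s = s₀
        · subst h1
          rw [a₁_s₀, a₁_ne s' (ne_of_gt hss'), hagree s' hss']
          exact hb hss'
        · by_cases h2 : s' = s₀
          · subst h2
            rw [a₁_s₀, a₁_ne s h1]
            exact (ha hss').trans hs₀lt
          · rw [a₁_ne s h1, a₁_ne s' h2]; exact ha hss'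
      have ha₁F : ∀ s, a₁ s ∈ F := fun s => by
        by_cases h : s = s₀
        · subst h; rw [a₁_s₀]; exact hbF _
        · rw [a₁_ne s h]; exact haF s
      have ha₁b : a₁ ≤ b := fun s => by
        by_cases h : s = s₀
        · subst h; rw [a₁_s₀]
        · rw [a₁_ne s h]; exact hab s
      -- the differing set shrinks
      have hD₁ : (univ.filter fun s => a₁ s < b s) = D.erase s₀ := by
        ext s
        simp only [Finset.mem_filter, Finset.mem_univ, true_and, Finset.mem_erase, hD]
        by_cases h : s = s₀
        · subst h; rw [a₁_s₀]; simp
        · rw [a₁_ne s h]; simp [h]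
      have hcard : (univ.filter fun s => a₁ s < b s).card < n := by
        rw [hD₁, Finset.card_erase_of_mem hs₀D, ← hn]
        exact Nat.sub_lt (Finset.card_pos.2 hDne) Nat.one_pos
      -- `img a₁ = insert (b s₀) ((img a).erase (a s₀))` and the shift hypothesis applies
      have hbnot : b s₀ ∉ univ.image a := by
        intro hmem
        obtain ⟨s, _, hs⟩ := Finset.mem_image.1 hmem
        rcases lt_trichotomy s s₀ with h | h | h
        · exact absurd ((ha h).trans hs₀lt) (by rw [hs]; exact lt_irrefl _)
        · rw [h] at hs; exact absurd hs₀lt (by rw [hs]; exact lt_irrefl _)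
        · have := hagree s h
          rw [hs] at this
          exact absurd (hb h) (by rw [← this]; exact lt_irrefl _)
      have himg : univ.image a₁ = insert (b s₀) ((univ.image a).erase (a s₀)) := by
        ext i
        simp only [Finset.mem_image, Finset.mem_univ, true_and, Finset.mem_insert, Finset.mem_erase]
        constructor
        · rintro ⟨s, hs⟩
          by_cases h : s = s₀
          · subst h; rw [a₁_s₀] at hs; exact Or.inl hs.symm
          · rw [a₁_ne s h] at hs
            refine Or.inr ⟨?_, ⟨s, hs⟩⟩
            rw [← hs]; exact fun heq => h (ha.injective heq)
        · rintro (hi | ⟨hne, ⟨s, hs⟩⟩)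
          · exact ⟨s₀, by rw [a₁_s₀, hi]⟩
          · have h : s ≠ s₀ := fun heq => hne (by rw [← hs, heq])
            exact ⟨s, by rw [a₁_ne s h, hs]⟩
      have hA₁ : (↑(univ.image a₁) : Set ι) ∈ A := by
        rw [himg]
        refine hAs (univ.image a) (fun i hi => ?_) hA (a s₀) (Finset.mem_image_of_mem a (Finset.mem_univ _)) (b s₀) (hbF _)
          hbnot hs₀lt
        obtain ⟨s, _, rfl⟩ := Finset.mem_image.1 hi
        exact haF s
      exact ih _ hcard a₁ ha₁mono ha₁F ha₁b rfl hA₁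

/-! ## §5 Measure level: same-direction shifted events are nonnegatively correlated on every layer -/

omit [Fintype ι] [LinearOrder ι] in
/-- A layer mass as a filtered pattern sum: `μ(X ∩ {N_F = k}) = Σ_{T ⊆ F, #T = k} w(T)·1_X(T)` for `X` determined by `F`. [folklore] -/
theorem real_inter_layer_eq_sum_filter [DecidableEq ι] (p : ι → unitInterval) (F : Finset ι) {X : Set (Set ι)}
    (hX : DeterminedBy X (↑F : Set ι)) (k : ℕ) :
    (prodBernoulli p).real (X ∩ {ω : Set ι | (F.filter (· ∈ ω)).card = k}) =
      ∑ T ∈ F.powerset.filter (fun T => T.card = k), wtW F (fun i => (p i : ℝ)) T * ind (pat X) T := by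
  rw [real_eq_sum_wtW_ind p (hX.inter (determinedBy_layer F k)), Finset.sum_filter]
  refine Finset.sum_congr rfl fun T hT => ?_
  rw [ind_pat_inter_layer F X k (Finset.mem_powerset.1 hT)]
  split_ifs <;> simp

/-- **SAME-DIRECTION SHIFTED EVENTS ARE NONNEGATIVELY CORRELATED ON EVERY LAYER, FOR EVERY PRODUCT MEASURE.**  If `A` and `B` are
determined by `F` and both right-shifted on `F` (w.r.t. the linear order of `ι`), then for every `k`:
`μ(A ∩ {N_F = k})·μ(B ∩ {N_F = k}) ≤ μ(A ∩ B ∩ {N_F = k})·μ{N_F = k}`. [this work] -/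
theorem real_layer_mul_le_of_rightShifted (p : ι → unitInterval) (F : Finset ι) {A B : Set (Set ι)}
    (hAF : DeterminedBy A (↑F : Set ι)) (hBF : DeterminedBy B (↑F : Set ι))
    (hAs : ∀ T : Finset ι, T ⊆ F → (↑T : Set ι) ∈ A → ∀ i ∈ T, ∀ j ∈ F, j ∉ T → i < j → (↑(insert j (T.erase i)) : Set ι) ∈ A)
    (hBs : ∀ T : Finset ι, T ⊆ F → (↑T : Set ι) ∈ B → ∀ i ∈ T, ∀ j ∈ F, j ∉ T → i < j → (↑(insert j (T.erase i)) : Set ι) ∈ B)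
    (k : ℕ) :
    (prodBernoulli p).real (A ∩ {ω : Set ι | (F.filter (· ∈ ω)).card = k}) *
        (prodBernoulli p).real (B ∩ {ω : Set ι | (F.filter (· ∈ ω)).card = k}) ≤
      (prodBernoulli p).real (A ∩ B ∩ {ω : Set ι | (F.filter (· ∈ ω)).card = k}) *
        (prodBernoulli p).real {ω : Set ι | (F.filter (· ∈ ω)).card = k} := by
  have huniv : DeterminedBy (Set.univ : Set (Set ι)) (↑F : Set ι) := by
    rw [determinedBy_iff]; intro ω ω' _; simp
  rw [real_inter_layer_eq_sum_filter p F hAF k, real_inter_layer_eq_sum_filter p F hBF k,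
    real_inter_layer_eq_sum_filter p F (hAF.inter hBF) k]
  have hU : (prodBernoulli p).real {ω : Set ι | (F.filter (· ∈ ω)).card = k} =
      ∑ T ∈ F.powerset.filter (fun T => T.card = k), wtW F (fun i => (p i : ℝ)) T := by
    have h := real_inter_layer_eq_sum_filter p F huniv k
    rw [Set.univ_inter] at h
    rw [h]
    refine Finset.sum_congr rfl fun T _ => ?_
    rw [ind_of_mem (show T ∈ pat (Set.univ : Set (Set ι)) from Set.mem_univ _), mul_one]
  rw [hU, mul_comm (∑ T ∈ F.powerset.filter (fun T => T.card = k), wtW F (fun i => (p i : ℝ)) T * ind (pat (A ∩ B)) T)]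
  have hAB : ∀ T, ind (pat (A ∩ B)) T = ind (pat A) T * ind (pat B) T := fun T => by rw [pat_inter, ind_inter]
  simp_rw [hAB]
  exact sum_layer_fkg_of_galeMonotone F (fun i => (p i : ℝ)) (fun i => (p i).2.1) (fun i => (p i).2.2) k
    (fun T => ind (pat A) T) (fun T => ind (pat B) T) (fun T => ind_nonneg _ _) (fun T => ind_nonneg _ _)
    (fun a b ha hb haF hbF hab => by
      by_cases h : (↑(univ.image a) : Set ι) ∈ A
      · rw [ind_of_mem (show univ.image a ∈ pat A from h),
          ind_of_mem (show univ.image b ∈ pat A from galeMonotone_of_rightShifted F hAs ha hb haF hbF hab h)]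
      · rw [ind_of_not_mem (show univ.image a ∉ pat A from h)]; exact ind_nonneg _ _)
    (fun a b ha hb haF hbF hab => by
      by_cases h : (↑(univ.image a) : Set ι) ∈ B
      · rw [ind_of_mem (show univ.image a ∈ pat B from h),
          ind_of_mem (show univ.image b ∈ pat B from galeMonotone_of_rightShifted F hBs ha hb haF hbF hab h)]
      · rw [ind_of_not_mem (show univ.image a ∉ pat B from h)]; exact ind_nonneg _ _)

end SahiOneStep

end Summit.CriticalPhenomena.PercolationContinuityZ3.Theorems
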